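import Summits.AnomalousDissipation.AnomalousDissipation.Theorems.SolenoidalFractalHomogenisationLagrangianStepSidebandResponse
import Summits.AnomalousDissipation.AnomalousDissipation.Theorems.SolenoidalFractalHomogenisationPermissibleFractalCarrierLayers
import Mathlib.Analysis.Calculus.Deriv.MeanValue
import HarnessLib

/-!
# K1L_D `LagrangianRenormalisationStepDesign` (stmt-AnomalousDissipation-27980), `stub_cellLawV0_IS` V0 — brick T2 (uniqueness and bounds):
# the periodic linear response of the truncated `ξ = 0` sideband system is UNIQUE and BOUNDED, so `Sideband.response` is characterised by its equation
# (helper; `--supports stmt-AnomalousDissipation-27980`)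

Summits-side helper file of route `SolenoidalFractalHomogenisation` (prover seat `ad-k1l-cellLawV-w1` g5; continues `…SidebandResponse`).  Everything proved;
no definitions, no named facts, no sorry.

* `norm_source_le` — `‖source W₁ R j t‖ ≤ 4π·‖slotAmp W₁ j‖` (two components, `‖P_z‖ ≤ 1`, envelope in `[0,1]`).
* `exists_isPeriodicResponse_norm_le` — a periodic response with the bound `‖N t‖ ≤ 8π‖slotAmp W₁ j‖/min(γ₁, 4π²lo')` on `[0,P]` (G7's `2δ/γ` with the explicit `δ`).
* **`isPeriodicResponse_unique`** — two periodic responses coincide on `[0,P]` (energy: `t ↦ e^{2γt}‖(N₁−N₂)(t)v‖²` is non-increasing by dissipativity of `gen`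
  (`…SidebandSkew.real_inner_gen_le`), and periodicity forces `‖(N₁−N₂)(0)v‖ = 0`).
* `eq_response_of_isPeriodicResponse` — hence ANY periodic response equals `Sideband.response` on `[0,P]`: clause-(i) provers may compute `M_{jj'}` from their own
  construction (`meanFeedback_eq_of_isPeriodicResponse`); `norm_response_le` — the bound for `response` (the `O(1/ν)` eddy response: for the data of `psiStar`,
  `γ = min(1, 4π²ν·lo)`).
NOT a proof of any registered stub, of the crux, or of anomalous dissipation; rung F-D1.A0 infrastructure.
-/

set_option linter.dupNamespace false

noncomputable section

namespace Summit.AnomalousDissipation.AnomalousDissipation.Theorems.SolenoidalFractalHomogenisation.LagrangianStep.Sideband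

open Set MeasureTheory Complex UnitAddTorus Filter Topology
open scoped InnerProductSpace
open Literature.Analysis Literature.Analysis.FunctionSpaces Literature.Analysis.FunctionSpaces.Torus
open Literature.Analysis.FluidPDE Literature.Analysis.FluidPDE.Torus Literature.Analysis.FluidPDE.LatticeShear
open Summit.AnomalousDissipation.AnomalousDissipation.Theorems.SolenoidalFractalHomogenisation.LagrangianStep.CellChain (norm_transversalProj_le)
open Summit.AnomalousDissipation.AnomalousDissipation.Theorems.SolenoidalFractalHomogenisation.PermissibleCarrier (period_pos trapezoid_nonneg trapezoid_le_one)

variable {k₀ : ℕ}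

/-! ## §1 The size of the unit source -/

/-- The envelope takes values in `[0,1]`. [cite: ArmstrongVicol2025, §4 p. 17 (time cutoff)] -/
theorem slotEnvelope_mem_Icc (W₁ : LatticeWord k₀) (j : Fin k₀) (t : ℝ) : slotEnvelope W₁ j t ∈ Icc (0:ℝ) 1 :=
  ⟨trapezoid_nonneg _ _ _ _, trapezoid_le_one _ _ _ _⟩

/-- A component of the unit source is at most `2π‖αⱼ‖` times the indicator of `z = ±mⱼ`. [cite: MajdaKramer1999, §2.2.1.3] -/
theorem norm_sourceComp_le (W₁ : LatticeWord k₀) (R : ℕ) (j : Fin k₀) (t : ℝ) (z : box R) (v : EuclideanSpace ℂ (Fin 3)) :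
    ‖sourceComp W₁ R j t z v‖ ≤
      ((if (z : Fin 3 → ℤ) = (W₁.phase j).m then 1 else 0) + (if (z : Fin 3 → ℤ) = -(W₁.phase j).m then 1 else 0)) *
        (2 * Real.pi * ‖slotAmp W₁ j‖ * ‖v‖) := by
  have henv := slotEnvelope_mem_Icc W₁ j t
  have hc : ∀ a : ℂ, ‖a‖ = ‖slotAmp W₁ j‖ →
      ‖(-(2 * Real.pi * Complex.I * ((slotEnvelope W₁ j t : ℝ) : ℂ) * a)) • transversalProj z.1 v‖ ≤ 2 * Real.pi * ‖slotAmp W₁ j‖ * ‖v‖ := by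
    intro a ha
    have hn : ‖(-(2 * Real.pi * Complex.I * ((slotEnvelope W₁ j t : ℝ) : ℂ) * a))‖ = 2 * Real.pi * slotEnvelope W₁ j t * ‖slotAmp W₁ j‖ := by
      rw [norm_neg]
      simp [abs_of_pos Real.pi_pos, abs_of_nonneg henv.1, ha]
    rw [norm_smul, hn]
    have hP := norm_transversalProj_le z.1 v
    have h3 : 2 * Real.pi * slotEnvelope W₁ j t * ‖slotAmp W₁ j‖ ≤ 2 * Real.pi * 1 * ‖slotAmp W₁ j‖ := by
      gcongr; exact henv.2
    calc 2 * Real.pi * slotEnvelope W₁ j t * ‖slotAmp W₁ j‖ * ‖transversalProj z.1 v‖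
        ≤ 2 * Real.pi * 1 * ‖slotAmp W₁ j‖ * ‖v‖ := mul_le_mul h3 hP (norm_nonneg _) (by positivity)
      _ = 2 * Real.pi * ‖slotAmp W₁ j‖ * ‖v‖ := by ring
  rw [sourceComp, add_apply]
  refine (norm_add_le _ _).trans ?_
  rw [add_mul]
  refine add_le_add ?_ ?_
  · split_ifs with h
    · rw [smul_apply, one_mul]; exact hc _ rfl
    · simp
  · split_ifs with h
    · rw [smul_apply, one_mul]; exact hc _ (by rw [RCLike.norm_conj])
    · simp

/-- At most one retained lattice point equals a given vector: `Σ_{z ∈ box} [z = w] ≤ 1`. [cite: MajdaKramer1999, §2.2.1.3] -/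
theorem sum_ite_coe_eq_le_one (R : ℕ) (w : Fin 3 → ℤ) : ∑ z : box R, (if (z : Fin 3 → ℤ) = w then (1:ℝ) else 0) ≤ 1 := by
  classical
  rw [Finset.sum_boole]
  have h : (Finset.univ.filter fun z : box R => (z : Fin 3 → ℤ) = w).card ≤ 1 :=
    Finset.card_le_one.2 fun a ha b hb => Subtype.ext (((Finset.mem_filter.1 ha).2).trans ((Finset.mem_filter.1 hb).2).symm)
  exact_mod_cast h

/-- **The unit source is bounded**: `‖source W₁ R j t‖ ≤ 4π‖αⱼ‖`. [cite: MajdaKramer1999, §2.2.1.3] -/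
theorem norm_source_le (W₁ : LatticeWord k₀) (R : ℕ) (j : Fin k₀) (t : ℝ) : ‖source W₁ R j t‖ ≤ 4 * Real.pi * ‖slotAmp W₁ j‖ := by
  classical
  refine ContinuousLinearMap.opNorm_le_bound _ (by positivity) fun v => ?_
  set a : ℝ := 2 * Real.pi * ‖slotAmp W₁ j‖ * ‖v‖ with ha
  have ha0 : 0 ≤ a := by positivity
  -- the square of the norm is the sum of the squared components
  have hsq : ‖source W₁ R j t v‖ ^ 2 = ∑ z : box R, ‖sourceComp W₁ R j t z v‖ ^ 2 := by
    rw [PiLp.norm_sq_eq_of_L2]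
    exact Finset.sum_congr rfl fun z _ => by rw [source_apply]
  have hcomp : ∀ z : box R, ‖sourceComp W₁ R j t z v‖ ^ 2 ≤
      2 * ((if (z : Fin 3 → ℤ) = (W₁.phase j).m then 1 else 0) + (if (z : Fin 3 → ℤ) = -(W₁.phase j).m then 1 else 0)) * a ^ 2 := by
    intro z
    have h := norm_sourceComp_le W₁ R j t z v
    rw [← ha] at h
    have hs : ((if (z : Fin 3 → ℤ) = (W₁.phase j).m then (1:ℝ) else 0) + (if (z : Fin 3 → ℤ) = -(W₁.phase j).m then 1 else 0)) ^ 2 ≤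
        2 * ((if (z : Fin 3 → ℤ) = (W₁.phase j).m then (1:ℝ) else 0) + (if (z : Fin 3 → ℤ) = -(W₁.phase j).m then 1 else 0)) := by
      split_ifs <;> norm_num
    calc ‖sourceComp W₁ R j t z v‖ ^ 2
        ≤ (((if (z : Fin 3 → ℤ) = (W₁.phase j).m then (1:ℝ) else 0) + (if (z : Fin 3 → ℤ) = -(W₁.phase j).m then 1 else 0)) * a) ^ 2 :=
          pow_le_pow_left₀ (norm_nonneg _) h 2
      _ = ((if (z : Fin 3 → ℤ) = (W₁.phase j).m then (1:ℝ) else 0) + (if (z : Fin 3 → ℤ) = -(W₁.phase j).m then 1 else 0)) ^ 2 * a ^ 2 := by ring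
      _ ≤ _ := mul_le_mul_of_nonneg_right hs (sq_nonneg a)
  have hsum : ‖source W₁ R j t v‖ ^ 2 ≤ 4 * a ^ 2 := by
    rw [hsq]
    refine (Finset.sum_le_sum fun z _ => hcomp z).trans ?_
    rw [← Finset.sum_mul, ← Finset.mul_sum, Finset.sum_add_distrib]
    have h1 := sum_ite_coe_eq_le_one R (W₁.phase j).m
    have h2 := sum_ite_coe_eq_le_one R (-(W₁.phase j).m)
    nlinarith [sq_nonneg a]
  have h4 : ‖source W₁ R j t v‖ ≤ 2 * a := by
    have h0 : 0 ≤ 2 * a := by positivity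
    nlinarith [norm_nonneg (source W₁ R j t v), hsum]
  calc ‖source W₁ R j t v‖ ≤ 2 * a := h4
    _ = 4 * Real.pi * ‖slotAmp W₁ j‖ * ‖v‖ := by rw [ha]; ring

/-! ## §2 Existence with the explicit bound -/

/-- **A periodic response with the bound `‖N t‖ ≤ 8π‖αⱼ‖/min(γ₁, 4π²lo')` on `[0,P]`.** [cite: SandersVerhulstMurdock2007, Lemma 5.2.7 (linear case)] -/
theorem exists_isPeriodicResponse_norm_le (W₁ : LatticeWord k₀) {𝔸 : Torus.Visc4 (Fin 3)} {lo' hi' : ℝ} (h𝔸 : Torus.NearIso 𝔸 lo' hi')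
    (hlo' : 0 < lo') {γ₁ : ℝ} (hγ₁ : 0 < γ₁) (R : ℕ) (j : Fin k₀) :
    ∃ N, IsPeriodicResponse W₁ 𝔸 γ₁ R j N ∧ ∀ t ∈ Icc 0 W₁.period, ‖N t‖ ≤ 8 * Real.pi * ‖slotAmp W₁ j‖ / min γ₁ (4 * Real.pi ^ 2 * lo') := by
  have hP : 0 < W₁.period := period_pos W₁
  set γ : ℝ := min γ₁ (4 * Real.pi ^ 2 * lo') with hγdef
  have hγ : 0 < γ := lt_min hγ₁ (by positivity)
  set δ₁ : ℝ := 4 * Real.pi * ‖slotAmp W₁ j‖ with hδ₁def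
  have hδ₁ : 0 ≤ δ₁ := by positivity
  set ε : ℝ := γ / (4 * (δ₁ + 1)) with hεdef
  have hε : 0 < ε := by positivity
  set δ : ℝ := ε * δ₁ with hδdef
  have hδ : 0 ≤ δ := by positivity
  have hδγ : δ ≤ γ / 4 := by
    rw [hδdef, hεdef, div_mul_eq_mul_div, div_le_div_iff₀ (by positivity) (by norm_num)]
    nlinarith [hγ.le, hδ₁]
  have h8 : 8 * δ ^ 2 ≤ γ ^ 2 := by nlinarith [hδγ, hδ, hγ.le]
  obtain ⟨Nε, hc, hd, hb, hp⟩ := SlowGraph.linearGraph_periodic_on (EuclideanSpace ℂ (Fin 3)) (Space R)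
    (fun t => ε • (source W₁ R j t).restrictScalars ℝ) (fun t => (gen W₁ 𝔸 γ₁ R t).restrictScalars ℝ) γ δ W₁.period W₁.period hδ hγ h8 hP le_rfl
    (fun t _ z => by
      rw [ContinuousLinearMap.coe_restrictScalars']
      exact real_inner_gen_le W₁ h𝔸 hlo'.le γ₁ R t z)
    (fun t _ => by
      rw [norm_smul, Real.norm_of_nonneg hε.le, ContinuousLinearMap.norm_restrictScalars]
      exact mul_le_mul_of_nonneg_left (norm_source_le W₁ R j t) hε.le)
    (by
      rw [continuousOn_clm_apply]
      intro v
      have h := ((continuous_clm_apply.1 (continuous_source W₁ R j)) v).const_smul ε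
      exact h.continuousOn.congr fun t _ => by simp)
    (by
      rw [continuousOn_clm_apply]
      intro v
      have h := (continuous_clm_apply.1 (continuous_gen W₁ 𝔸 γ₁ R)) v
      exact h.continuousOn.congr fun t _ => by simp)
    (fun t _ _ => by rw [source_add_period])
    (fun t _ _ => by rw [gen_add_period])
  have hper : Nε W₁.period = Nε 0 := by
    have h := hp 0 le_rfl (by rw [zero_add])
    rwa [zero_add] at h
  refine ⟨fun t => ε⁻¹ • Nε t, ⟨hc.const_smul ε⁻¹, fun t ht => ?_, by simp only [hper]⟩, fun t ht => ?_⟩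
  · have h := (hd t ht).const_smul ε⁻¹
    refine h.congr_deriv ?_
    rw [smul_add, smul_smul, inv_mul_cancel₀ hε.ne', one_smul, ContinuousLinearMap.comp_smul]
  · rw [norm_smul, norm_inv, Real.norm_of_nonneg hε.le]
    have h1 := hb t ht
    calc ε⁻¹ * ‖Nε t‖ ≤ ε⁻¹ * (2 * δ / γ) := mul_le_mul_of_nonneg_left h1 (by positivity)
      _ = 2 * δ₁ / γ := by rw [hδdef]; field_simp
      _ = 8 * Real.pi * ‖slotAmp W₁ j‖ / γ := by rw [hδ₁def]; ring

/-! ## §3 Uniqueness of the periodic response -/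

/-- **UNIQUENESS**: for `NearIso 𝔸 lo' hi'` with `lo' > 0` and `γ₁ > 0`, two periodic responses of the same slot coincide on `[0,P]`.
[cite: SandersVerhulstMurdock2007, Lemma 5.2.7 (linear case)] -/
theorem isPeriodicResponse_unique (W₁ : LatticeWord k₀) {𝔸 : Torus.Visc4 (Fin 3)} {lo' hi' : ℝ} (h𝔸 : Torus.NearIso 𝔸 lo' hi') (hlo' : 0 < lo')
    {γ₁ : ℝ} (hγ₁ : 0 < γ₁) {R : ℕ} {j : Fin k₀} {N₁ N₂ : ℝ → (EuclideanSpace ℂ (Fin 3) →L[ℝ] Space R)}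
    (h₁ : IsPeriodicResponse W₁ 𝔸 γ₁ R j N₁) (h₂ : IsPeriodicResponse W₁ 𝔸 γ₁ R j N₂) :
    ∀ t ∈ Icc 0 W₁.period, N₁ t = N₂ t := by
  have hP : 0 < W₁.period := period_pos W₁
  set γ : ℝ := min γ₁ (4 * Real.pi ^ 2 * lo') with hγdef
  have hγ : 0 < γ := lt_min hγ₁ (by positivity)
  obtain ⟨hc₁, hd₁, hp₁⟩ := h₁
  obtain ⟨hc₂, hd₂, hp₂⟩ := h₂
  -- the difference solves the homogeneous equation
  have hD : ∀ t ∈ Ico 0 W₁.period, HasDerivAt (fun s => N₁ s - N₂ s)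
      (((gen W₁ 𝔸 γ₁ R t).restrictScalars ℝ).comp (N₁ t - N₂ t)) t := by
    intro t ht
    have h := (hd₁ t ht).sub (hd₂ t ht)
    refine h.congr_deriv ?_
    rw [ContinuousLinearMap.comp_sub]; abel
  -- fix a test vector
  suffices hv : ∀ v : EuclideanSpace ℂ (Fin 3), ∀ t ∈ Icc 0 W₁.period, (N₁ t - N₂ t) v = 0 by
    intro t ht
    have := fun v => hv v t ht
    exact sub_eq_zero.1 (ContinuousLinearMap.ext this)
  intro v
  set φ : ℝ → ℝ := fun s => ‖(N₁ s - N₂ s) v‖ ^ 2 with hφ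
  set ψ : ℝ → ℝ := fun s => Real.exp (2 * γ * s) * φ s with hψ
  -- derivative of `φ` and the dissipation bound
  have hφd : ∀ t ∈ Ico 0 W₁.period, HasDerivAt φ
      (2 * ⟪(N₁ t - N₂ t) v, (((gen W₁ 𝔸 γ₁ R t).restrictScalars ℝ).comp (N₁ t - N₂ t)) v + (N₁ t - N₂ t) 0⟫_ℝ) t :=
    fun t ht => ((hD t ht).clm_apply (hasDerivAt_const t v)).norm_sq
  have hφb : ∀ t ∈ Ico 0 W₁.period,
      2 * ⟪(N₁ t - N₂ t) v, (((gen W₁ 𝔸 γ₁ R t).restrictScalars ℝ).comp (N₁ t - N₂ t)) v + (N₁ t - N₂ t) 0⟫_ℝ ≤ -(2 * γ) * φ t := by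
    intro t ht
    rw [map_zero, add_zero, ContinuousLinearMap.comp_apply, real_inner_comm, ContinuousLinearMap.coe_restrictScalars']
    have h := real_inner_gen_le W₁ h𝔸 hlo'.le γ₁ R t ((N₁ t - N₂ t) v)
    have hφt : φ t = ‖(N₁ t - N₂ t) v‖ ^ 2 := rfl
    rw [hφt]
    linarith
  -- `ψ` is continuous on `[0,P]` and non-increasing
  have hφc : ContinuousOn φ (Icc 0 W₁.period) := by
    have h1 : ContinuousOn (fun s => (N₁ s - N₂ s) v) (Icc 0 W₁.period) := (hc₁.sub hc₂).clm_apply continuousOn_const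
    exact (h1.norm).pow 2
  have hψc : ContinuousOn ψ (Icc 0 W₁.period) := (Real.continuous_exp.comp (continuous_const.mul continuous_id)).continuousOn.mul hφc
  have hψd : ∀ t ∈ Ico 0 W₁.period, HasDerivAt ψ (Real.exp (2 * γ * t) * (2 * γ) * φ t +
      Real.exp (2 * γ * t) * (2 * ⟪(N₁ t - N₂ t) v, (((gen W₁ 𝔸 γ₁ R t).restrictScalars ℝ).comp (N₁ t - N₂ t)) v + (N₁ t - N₂ t) 0⟫_ℝ)) t := by
    intro t ht
    have he : HasDerivAt (fun s => Real.exp (2 * γ * s)) (Real.exp (2 * γ * t) * (2 * γ)) t := by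
      have := ((hasDerivAt_id t).const_mul (2 * γ)).exp
      simpa using this
    exact he.mul (hφd t ht)
  have hanti : AntitoneOn ψ (Icc 0 W₁.period) := by
    refine antitoneOn_of_deriv_nonpos (convex_Icc 0 W₁.period) hψc ?_ ?_
    · rw [interior_Icc]
      intro t ht
      exact (hψd t ⟨ht.1.le, ht.2⟩).differentiableAt.differentiableWithinAt
    · rw [interior_Icc]
      intro t ht
      rw [(hψd t ⟨ht.1.le, ht.2⟩).deriv]
      have h := hφb t ⟨ht.1.le, ht.2⟩
      have hpos : 0 < Real.exp (2 * γ * t) := Real.exp_pos _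
      nlinarith
  -- periodicity forces `φ 0 = 0`
  have hφP : φ W₁.period = φ 0 := by simp only [hφ, hp₁, hp₂]
  have hφ0 : φ 0 = 0 := by
    have h1 : ψ W₁.period ≤ ψ 0 := hanti ⟨le_rfl, hP.le⟩ ⟨hP.le, le_rfl⟩ hP.le
    simp only [hψ, mul_zero, Real.exp_zero, one_mul, hφP] at h1
    have hgt : 1 < Real.exp (2 * γ * W₁.period) := Real.one_lt_exp_iff.2 (by positivity)
    have hnn : 0 ≤ φ 0 := sq_nonneg _
    nlinarith
  -- hence `φ ≡ 0` on `[0,P]`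
  intro t ht
  have h1 : ψ t ≤ ψ 0 := hanti ⟨le_rfl, hP.le⟩ ht ht.1
  simp only [hψ, mul_zero, Real.exp_zero, hφ0] at h1
  have hpos : 0 < Real.exp (2 * γ * t) := Real.exp_pos _
  have hφt : φ t = 0 := le_antisymm (by nlinarith [sq_nonneg ‖(N₁ t - N₂ t) v‖]) (sq_nonneg _)
  simpa [hφ] using hφt

/-! ## §4 Characterisation and bounds of `Sideband.response` -/

/-- **Any periodic response IS `Sideband.response`** on `[0,P]`. [cite: SandersVerhulstMurdock2007, Lemma 5.2.7 (linear case)] -/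
theorem eq_response_of_isPeriodicResponse (W₁ : LatticeWord k₀) {𝔸 : Torus.Visc4 (Fin 3)} {lo' hi' : ℝ} (h𝔸 : Torus.NearIso 𝔸 lo' hi')
    (hlo' : 0 < lo') {γ₁ : ℝ} (hγ₁ : 0 < γ₁) {R : ℕ} {j : Fin k₀} {N : ℝ → (EuclideanSpace ℂ (Fin 3) →L[ℝ] Space R)}
    (hN : IsPeriodicResponse W₁ 𝔸 γ₁ R j N) : ∀ t ∈ Icc 0 W₁.period, N t = response W₁ 𝔸 γ₁ R j t :=
  isPeriodicResponse_unique W₁ h𝔸 hlo' hγ₁ hN (isPeriodicResponse_response ⟨N, hN⟩)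

/-- **The response is bounded**: `‖response t‖ ≤ 8π‖αⱼ‖/min(γ₁, 4π²lo')` on `[0,P]`. [cite: SandersVerhulstMurdock2007, Lemma 5.2.7 (linear case)] -/
theorem norm_response_le (W₁ : LatticeWord k₀) {𝔸 : Torus.Visc4 (Fin 3)} {lo' hi' : ℝ} (h𝔸 : Torus.NearIso 𝔸 lo' hi') (hlo' : 0 < lo')
    {γ₁ : ℝ} (hγ₁ : 0 < γ₁) (R : ℕ) (j : Fin k₀) {t : ℝ} (ht : t ∈ Icc 0 W₁.period) :
    ‖response W₁ 𝔸 γ₁ R j t‖ ≤ 8 * Real.pi * ‖slotAmp W₁ j‖ / min γ₁ (4 * Real.pi ^ 2 * lo') := by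
  obtain ⟨N, hN, hb⟩ := exists_isPeriodicResponse_norm_le W₁ h𝔸 hlo' hγ₁ R j
  rw [← eq_response_of_isPeriodicResponse W₁ h𝔸 hlo' hγ₁ hN t ht]
  exact hb t ht

/-- **The feedback matrix may be computed from ANY periodic response.** [cite: MajdaKramer1999, §2.2.1.3 (55)] -/
theorem meanFeedback_eq_of_isPeriodicResponse (W₁ : LatticeWord k₀) {𝔸 : Torus.Visc4 (Fin 3)} {lo' hi' : ℝ} (h𝔸 : Torus.NearIso 𝔸 lo' hi')
    (hlo' : 0 < lo') {γ₁ : ℝ} (hγ₁ : 0 < γ₁) {R : ℕ} (j : Fin k₀) {j' : Fin k₀} {N : ℝ → (EuclideanSpace ℂ (Fin 3) →L[ℝ] Space R)}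
    (hN : IsPeriodicResponse W₁ 𝔸 γ₁ R j' N) :
    meanFeedback W₁ 𝔸 γ₁ R j j' = (1 / W₁.period) • ∫ t in (0:ℝ)..W₁.period, ((feedback W₁ R j t).restrictScalars ℝ).comp (N t) := by
  have hint : ∫ t in (0:ℝ)..W₁.period, ((feedback W₁ R j t).restrictScalars ℝ).comp (response W₁ 𝔸 γ₁ R j' t) =
      ∫ t in (0:ℝ)..W₁.period, ((feedback W₁ R j t).restrictScalars ℝ).comp (N t) := by
    refine intervalIntegral.integral_congr fun t ht => ?_
    rw [uIcc_of_le (period_pos W₁).le] at ht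
    simp only [eq_response_of_isPeriodicResponse W₁ h𝔸 hlo' hγ₁ hN t ht]
  rw [meanFeedback, hint]

end Summit.AnomalousDissipation.AnomalousDissipation.Theorems.SolenoidalFractalHomogenisation.LagrangianStep.Sideband

end
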